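import Summits.Ventures.HSemireg.WeilFamilyBracket
import HarnessLib

/-!
# Venture HSemireg — the real Lie algebra generated by the Weil directions contains `𝔰𝔲(H)`

Continuation of `WeilFamilyBracket` (van Geemen's model `U = P × P`, directions
`T_B (x₁, x₂) = (B† x₂, B x₁)`; there: `span_ℝ [𝔭, 𝔭] = 𝔰(𝔲(P) ⊕ 𝔲(P))` as pairs of blocks). Here the
directions are regarded as elements of the associative algebra `End_ℂ(P × P)`,
`T_B = (B†.prodMap B) ∘ swap`, with the commutator `X * Y - Y * X` as bracket. To stay free of
instance choices the «Lie subalgebra generated by `𝔭`» is replaced by its universal property: an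
arbitrary real subspace `K ⊆ End_ℂ(P × P)` containing every `T_B` and closed under commutators.

* `mul_offDiag_sub` : `T_B T_C - T_C T_B = (B†C - C†B).prodMap (BC† - CB†)`;
* `prodMap_mem_of_mem_span`: transport of `span_ℝ [𝔭,𝔭]` into any such `K`;
* `blocks_mem_of_commutator_closed` (**`Lie_ℝ⟨𝔭⟩ ⊇ 𝔰𝔲(H)`**): for `dim_ℂ P ≥ 1`, every endomorphism of
  block shape `[[S, C†], [C, T]] = S.prodMap T + T_C` with `S, T` skew-adjoint and `tr S + tr T = 0`
  lies in every such `K`; `hermForm_blocks` / `trace_blocks` record that this block shape is «`H`-skew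
  with complex trace `tr S + tr T`», i.e. these are exactly the elements of `𝔰𝔲(H)` for the
  signature-`(n,n)` form `H` of the Literature file (`𝔭 ⊆ 𝔰𝔲(H)` is `hermForm_offDiag` there);
* `act_eq_zero_of_forall_offDiag` (**annihilators**): for any real-linear `ρ : End_ℂ(P × P) → End_ℝ(M)`
  turning commutators into commutators (a Lie action, e.g. the derivation action on real cohomology)
  and any `κ ∈ M` killed by every `ρ(T_B)`: `κ` is killed by `ρ(X)` for every `X ∈ 𝔰𝔲(H)`.

HONEST FRAMING. Elementary linear algebra; Lean index of the computation cell `pub-hsemireg`, seat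
`w1-tw-1` (W1): the «Lie step» of the record's THEOREM T (3a) and of THEOREM CC (S5♯)
(`widen/W1/CLEAN-COMPONENT-THEOREM-w1tw1.md`): a real cohomology class of a member of the Weil family
that is first-order horizontal along every Weil direction is killed by `𝔰𝔲(H)` and is therefore
`SU(H)`-invariant, i.e. a generic Hodge class of the component ([vG94] Thm. 6.12, printed — NOT
formalised here). The action `ρ` on cohomology is NOT constructed here (the annihilator statement is
proved for an arbitrary action); no abelian variety, Hodge class or semiregularity map appears in this
file; nothing here says that HC, HC_CM or HC_AV holds, and nothing here is a new case of anything.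
-/

noncomputable section

open Complex Module
open scoped InnerProductSpace ComplexConjugate

namespace Summit.Ventures.HSemireg

namespace WeilFamily

open Literature.AlgebraicGeometry.HodgeTheory.WeilFamily

variable {P : Type*} [NormedAddCommGroup P] [InnerProductSpace ℂ P] [FiniteDimensional ℂ P]

/-- `T_B` as an endomorphism of `P × P`: `(B†.prodMap B) ∘ swap`, i.e. `x ↦ (B† x₂, B x₁) = offDiag B x`.
[folklore] -/
theorem prodMap_adjoint_comp_prodComm_apply (B : P →ₗ[ℂ] P) (x : P × P) :
    ((LinearMap.adjoint B).prodMap B ∘ₗ (LinearEquiv.prodComm ℂ P P).toLinearMap) x = offDiag B x :=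
  rfl

/-- The commutator of two directions in `End_ℂ(P × P)` is the block-diagonal endomorphism
`(B†C - C†B).prodMap (BC† - CB†)`. [folklore] -/
theorem mul_offDiag_sub (B C : P →ₗ[ℂ] P) :
    ((LinearMap.adjoint B).prodMap B ∘ₗ (LinearEquiv.prodComm ℂ P P).toLinearMap : Module.End ℂ (P × P)) *
        ((LinearMap.adjoint C).prodMap C ∘ₗ (LinearEquiv.prodComm ℂ P P).toLinearMap) -
      ((LinearMap.adjoint C).prodMap C ∘ₗ (LinearEquiv.prodComm ℂ P P).toLinearMap : Module.End ℂ (P × P)) *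
        ((LinearMap.adjoint B).prodMap B ∘ₗ (LinearEquiv.prodComm ℂ P P).toLinearMap) =
      (LinearMap.adjoint B ∘ₗ C - LinearMap.adjoint C ∘ₗ B).prodMap
        (B ∘ₗ LinearMap.adjoint C - C ∘ₗ LinearMap.adjoint B) := by
  ext x <;> simp

section Span

variable (K : Submodule ℝ (Module.End ℂ (P × P)))
  (hK𝔭 : ∀ B : P →ₗ[ℂ] P,
    ((LinearMap.adjoint B).prodMap B ∘ₗ (LinearEquiv.prodComm ℂ P P).toLinearMap : Module.End ℂ (P × P)) ∈ K)
  (hKc : ∀ X Y : Module.End ℂ (P × P), X ∈ K → Y ∈ K → X * Y - Y * X ∈ K)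
include hK𝔭 hKc

/-- TRANSPORT: if a real subspace `K ⊆ End_ℂ(P × P)` contains every direction and is closed under
commutators, then it contains `S.prodMap T` for every `(S, T) ∈ span_ℝ [𝔭,𝔭]`. [folklore] -/
theorem prodMap_mem_of_mem_span {p : (P →ₗ[ℂ] P) × (P →ₗ[ℂ] P)}
    (hp : p ∈ (Submodule.span ℝ {p : (P →ₗ[ℂ] P) × (P →ₗ[ℂ] P) | ∃ B C : P →ₗ[ℂ] P,
        p = (LinearMap.adjoint B ∘ₗ C - LinearMap.adjoint C ∘ₗ B, B ∘ₗ LinearMap.adjoint C - C ∘ₗ LinearMap.adjoint B)})) :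
    (p.1.prodMap p.2 : Module.End ℂ (P × P)) ∈ K := by
  induction hp using Submodule.span_induction with
  | mem p hp =>
      obtain ⟨B, C, rfl⟩ := hp
      rw [← mul_offDiag_sub]
      exact hKc _ _ (hK𝔭 B) (hK𝔭 C)
  | zero =>
      rw [Prod.fst_zero, Prod.snd_zero, LinearMap.prodMap_zero]
      exact K.zero_mem
  | add p q _ _ hp hq =>
      rw [Prod.fst_add, Prod.snd_add, LinearMap.prodMap_add]
      exact K.add_mem hp hq
  | smul r p _ hp =>
      have e : ((r • p).1.prodMap (r • p).2 : Module.End ℂ (P × P)) = r • (p.1.prodMap p.2) := by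
        ext x <;> simp
      rw [e]
      exact K.smul_mem r hp

/-- **`Lie_ℝ⟨𝔭⟩ ⊇ 𝔰𝔲(H)`.** For `dim_ℂ P ≥ 1`: every real subspace `K` of `End_ℂ(P × P)` containing all
directions `T_B` and closed under commutators contains every endomorphism of the block shape
`[[S, C†], [C, T]] = S.prodMap T + T_C` with `S, T` skew-adjoint and `tr S + tr T = 0` — i.e. (by
`hermForm_blocks`, `trace_blocks` and `hermForm_offDiag`) the whole of `𝔰𝔲(H)`; so the real Lie algebra
generated by the Weil directions is `𝔰𝔲(H) = 𝔰(𝔲(P) ⊕ 𝔲(P)) ⊕ 𝔭`. [folklore] -/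
theorem blocks_mem_of_commutator_closed (h1 : 1 ≤ finrank ℂ P) {S T : P →ₗ[ℂ] P} (C : P →ₗ[ℂ] P)
    (hS : LinearMap.adjoint S = -S) (hT : LinearMap.adjoint T = -T)
    (htr : LinearMap.trace ℂ P S + LinearMap.trace ℂ P T = 0) :
    (S.prodMap T + (LinearMap.adjoint C).prodMap C ∘ₗ (LinearEquiv.prodComm ℂ P P).toLinearMap :
        Module.End ℂ (P × P)) ∈ K :=
  K.add_mem (prodMap_mem_of_mem_span K hK𝔭 hKc (p := (S, T)) (mem_bracketSpan h1 hS hT htr)) (hK𝔭 C)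

end Span

/-- The block shape `[[S, C†], [C, T]]` with `S, T` skew-adjoint is `H`-skew, i.e. lies in `𝔲(H)`
for `H((x₁,x₂),(y₁,y₂)) = ⟪x₁,y₁⟫ - ⟪x₂,y₂⟫`. [folklore] -/
theorem hermForm_blocks {S T : P →ₗ[ℂ] P} (C : P →ₗ[ℂ] P)
    (hS : LinearMap.adjoint S = -S) (hT : LinearMap.adjoint T = -T) (x y : P × P) :
    hermForm ((S.prodMap T + (LinearMap.adjoint C).prodMap C ∘ₗ (LinearEquiv.prodComm ℂ P P).toLinearMap) x) y +
      hermForm x ((S.prodMap T + (LinearMap.adjoint C).prodMap C ∘ₗ (LinearEquiv.prodComm ℂ P P).toLinearMap) y) = 0 := by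
  have hS' : ∀ u v : P, ⟪S u, v⟫_ℂ = -⟪u, S v⟫_ℂ := fun u v ↦ by
    rw [← LinearMap.adjoint_inner_left, hS, LinearMap.neg_apply, inner_neg_left, neg_neg]
  have hT' : ∀ u v : P, ⟪T u, v⟫_ℂ = -⟪u, T v⟫_ℂ := fun u v ↦ by
    rw [← LinearMap.adjoint_inner_left, hT, LinearMap.neg_apply, inner_neg_left, neg_neg]
  simp only [hermForm, LinearMap.add_apply, LinearMap.prodMap_apply, LinearMap.coe_comp,
    LinearEquiv.coe_coe, Function.comp_apply, LinearEquiv.prodComm_apply, Prod.swap, Prod.fst_add,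
    Prod.snd_add, inner_add_left, inner_add_right, LinearMap.adjoint_inner_left,
    LinearMap.adjoint_inner_right, hS', hT']
  ring

/-- Trace of the block shape: `tr_ℂ [[S, C†],[C, T]] = tr S + tr T` (the off-diagonal part is the
commutator of `D(i·𝟙, 0)` with `T_{iC}`, hence traceless); so the trace condition of
`blocks_mem_of_commutator_closed` is `tr_ℂ X = 0`. [folklore] -/
theorem trace_blocks (S T C : P →ₗ[ℂ] P) :
    LinearMap.trace ℂ (P × P)
        (S.prodMap T + (LinearMap.adjoint C).prodMap C ∘ₗ (LinearEquiv.prodComm ℂ P P).toLinearMap) =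
      LinearMap.trace ℂ P S + LinearMap.trace ℂ P T := by
  rw [map_add, LinearMap.trace_prodMap']
  suffices h : LinearMap.trace ℂ (P × P)
      ((LinearMap.adjoint C).prodMap C ∘ₗ (LinearEquiv.prodComm ℂ P P).toLinearMap) = 0 by
    rw [h, add_zero]
  have key : ((LinearMap.adjoint C).prodMap C ∘ₗ (LinearEquiv.prodComm ℂ P P).toLinearMap :
      Module.End ℂ (P × P)) =
      ((Complex.I • LinearMap.id).prodMap 0 : Module.End ℂ (P × P)) *
          ((LinearMap.adjoint (Complex.I • C)).prodMap (Complex.I • C) ∘ₗ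
            (LinearEquiv.prodComm ℂ P P).toLinearMap) -
        ((LinearMap.adjoint (Complex.I • C)).prodMap (Complex.I • C) ∘ₗ
            (LinearEquiv.prodComm ℂ P P).toLinearMap : Module.End ℂ (P × P)) *
          ((Complex.I • LinearMap.id).prodMap 0) := by
    ext x <;> simp [map_smulₛₗ, Complex.conj_I, smul_smul]
  rw [key, map_sub, LinearMap.trace_mul_comm, sub_self]

/-- **Annihilators.** Let `ρ : End_ℂ(P × P) → End_ℝ(M)` be real-linear and turn commutators into
commutators (a Lie action on a real vector space `M`; in the cell's use: real cohomology `H^•(A₀, ℝ)`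
with the derivation action, `𝔭` acting as the Weil directions). If every `ρ(T_B)` kills `κ ∈ M`, then
`ρ(X) κ = 0` for every `X ∈ 𝔰𝔲(H)` (block shape `[[S, C†],[C, T]]`, `S, T` skew-adjoint,
`tr S + tr T = 0`), for `dim_ℂ P ≥ 1`: the annihilator of `κ` is a real subspace containing `𝔭` and
closed under commutators. This is the Lie step of THEOREM T (3a) / THEOREM CC (S5♯): «killed by all Weil
directions ⇒ killed by 𝔰𝔲(H) ⇒ SU(H)-invariant». [folklore] -/
theorem act_eq_zero_of_forall_offDiag (h1 : 1 ≤ finrank ℂ P) {M : Type*} [AddCommGroup M] [Module ℝ M]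
    (ρ : Module.End ℂ (P × P) →ₗ[ℝ] Module.End ℝ M)
    (hρ : ∀ X Y : Module.End ℂ (P × P), ρ (X * Y - Y * X) = ρ X * ρ Y - ρ Y * ρ X) (κ : M)
    (hκ : ∀ B : P →ₗ[ℂ] P,
      ρ ((LinearMap.adjoint B).prodMap B ∘ₗ (LinearEquiv.prodComm ℂ P P).toLinearMap) κ = 0)
    {S T : P →ₗ[ℂ] P} (C : P →ₗ[ℂ] P) (hS : LinearMap.adjoint S = -S) (hT : LinearMap.adjoint T = -T)
    (htr : LinearMap.trace ℂ P S + LinearMap.trace ℂ P T = 0) :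
    ρ (S.prodMap T + (LinearMap.adjoint C).prodMap C ∘ₗ (LinearEquiv.prodComm ℂ P P).toLinearMap) κ = 0 := by
  let K : Submodule ℝ (Module.End ℂ (P × P)) :=
    { carrier := {X | ρ X κ = 0}
      add_mem' := fun {a b} ha hb => by
        simp only [Set.mem_setOf_eq] at ha hb ⊢
        rw [map_add, LinearMap.add_apply, ha, hb, add_zero]
      zero_mem' := by simp only [Set.mem_setOf_eq, map_zero, LinearMap.zero_apply]
      smul_mem' := fun r {a} ha => by
        simp only [Set.mem_setOf_eq] at ha ⊢
        rw [map_smul, LinearMap.smul_apply, ha, smul_zero] }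
  have hKc : ∀ X Y : Module.End ℂ (P × P), X ∈ K → Y ∈ K → X * Y - Y * X ∈ K := by
    intro X Y hX hY
    change ρ X κ = 0 at hX
    change ρ Y κ = 0 at hY
    change ρ (X * Y - Y * X) κ = 0
    rw [hρ, LinearMap.sub_apply, Module.End.mul_apply, Module.End.mul_apply, hX, hY, map_zero,
      map_zero, sub_zero]
  exact blocks_mem_of_commutator_closed K hκ hKc h1 C hS hT htr

end WeilFamily

end Summit.Ventures.HSemireg
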